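import Mathlib
import HarnessLib
import Literature.Analysis.FluidPDE.ClassicalSolution
import Literature.Analysis.FluidPDE.LerayHopf
import Literature.Analysis.FluidPDE.SelfSimilar
import Literature.Analysis.FluidPDE.LocalTypeI
import Literature.Analysis.FluidPDE.VectorCalculus
import Literature.Analysis.FluidPDE.SereginSverak2002PressureLowerBound
import Literature.Analysis.FluidPDE.TypeIAncientMild
import Literature.Analysis.UnboundedOperators.HeatKernel
import Literature.Analysis.FluidPDE.TaoEnstrophyLocalisation
import Literature.Analysis.FluidPDE.NSLocalLerayBackwardUniqueness
import Summits.NavierStokesRegularity.NavierStokesRegularity.Theorems.LocalSineTubeDoorLocalPointZoomGradSlices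
import Summits.NavierStokesRegularity.NavierStokesRegularity.Theorems.LocalSineTubeDoorProfileAlignedWindowRigidityAncient

/-!
# DirectionEchoDoorDefs — S24 «DirectionEchoDoor» (the Constantin–Fefferman quantity in two-time form), part 1/2

§0 the two-time DIRECTION defect observable `dirEchoDefect` / `DirEchoFades`, the profile-side notions
`HasParallelVorticityEcho`, `HasScaleInvariantVorticityDirection`, and the texts K1-dir `LocalPointZoomDirEcho`, K2-dir
`SIDirectionLiouville`, door `TargetDirEchoAllRatios`, `DirEchoAssembly` (the bare name `Assembly` is reserved for route files).  Definitions only.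

Door family of LADDER-NS N0 (local Type-I window doors S20–S24); THEOREMS-ONLY landing of the nsreg-p1 design
`run/shared/lean/pub/ns-regularity-ideate/ns-regularity-ideate-p1/r23/Sketch24seedK1.lean` 6dc70f138da379af (ROUND-23.md
36a066550160a20a).  Door T2-dir «direction echo at all ratios»: K1-dir `LocalPointZoomDirEcho` PROVED (part 2/2), the door
`closesDirEcho` PROVED (logic), CONDITIONAL on exactly one OPEN typed statement K2-dir `SIDirectionLiouville` (a Liouville theorem for
Type-I ancient profiles with SCALE-INVARIANT VORTICITY DIRECTION; hypothesis class ⊋ self-similar ∪ constant-direction ∪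
axisymmetric-no-swirl; not in print).  No route, no items (DIRECTOR-NS standing #32 (2)).  WHAT THIS IS NOT: not a regularity
claim; K2-dir is NOT asserted, it is the seat-purpose deliverable «the exact first statement not in print».
-/

noncomputable section

set_option linter.dupNamespace false
set_option linter.unusedVariables false

namespace Summit.NavierStokesRegularity.NavierStokesRegularity.Theorems.DirectionEchoDoorDefs

open MeasureTheory Set Function Filter Topology TopologicalSpace Metric
open scoped RealInnerProductSpace NNReal ENNReal Topology Pointwise
open Literature.Analysis Literature.Analysis.FluidPDE
open Summit.NavierStokesRegularity.NavierStokesRegularity.Theorems.LocalSineTubeDoorProfileAlignedWindowRigidityAncient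

/-! ## §0 The observable: the two-time DIRECTION defect through a peephole -/

/-- The **two-time direction defect** of `u` at `(x₀, T)` and ratio `κ`, read at time `t` and similarity position `y`:
the norm of the cross product of the scale-normalised vorticity `(T−t)·ω(t, x₀ + √(T−t) y)` with the scale-normalised
vorticity `(T−t')·ω(t', x₀ + √(T−t') y)` at the parabolically related time `t' = T − κ(T−t)` — equal to
`(T−t)(T−t') |ω| |ω'| sin ∠(ω, ω')`, the Constantin–Fefferman depletion quantity in two-time form.  It vanishes iff the
two vorticities are parallel (or one is zero); the MAGNITUDES are not compared. -/
def dirEchoDefect (T : ℝ) (x₀ : EuclideanSpace ℝ (Fin 3)) (u : ℝ → EuclideanSpace ℝ (Fin 3) → EuclideanSpace ℝ (Fin 3))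
    (κ t : ℝ) (y : EuclideanSpace ℝ (Fin 3)) : ℝ :=
  ‖cross ((T - t) • curl (u t) (x₀ + Real.sqrt (T - t) • y))
      ((κ * (T - t)) • curl (u (T - κ * (T - t))) (x₀ + Real.sqrt (κ * (T - t)) • y))‖

/-- **The direction defect FADES on the window `U`**: `∫_U dirEchoDefect(t, y) dy → 0` as `t → T⁻`. -/
def DirEchoFades (T : ℝ) (x₀ : EuclideanSpace ℝ (Fin 3)) (u : ℝ → EuclideanSpace ℝ (Fin 3) → EuclideanSpace ℝ (Fin 3))
    (κ : ℝ) (U : Set (EuclideanSpace ℝ (Fin 3))) : Prop :=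
  Filter.Tendsto (fun t => ∫⁻ y in U, ENNReal.ofReal (dirEchoDefect T x₀ u κ t y)) (nhdsWithin T (Set.Iio T)) (nhds 0)

/-- The **parallel vorticity echo** at ratio `κ` imprinted on a profile `v` on the open backward slab:
`ω_v(s, z) × ω_v(κ s, √κ z) = 0` for all `s < 0`, `z`.  (For a discretely self-similar profile with factor `(√κ)⁻¹`
this holds at the ONE ratio `κ`; for a self-similar profile at every ratio.) -/
def HasParallelVorticityEcho (κ : ℝ) (v : ℝ → EuclideanSpace ℝ (Fin 3) → EuclideanSpace ℝ (Fin 3)) : Prop :=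
  ∀ s < 0, ∀ z, cross (curl (v s) z) (curl (v (κ * s)) (Real.sqrt κ • z)) = 0

/-- **Scale-invariant vorticity direction**: the parallel vorticity echo at EVERY ratio `κ ∈ (0,1)` — the vorticity
DIRECTION field of `v` is invariant under all parabolic dilations (where `ω_v ≠ 0`), the magnitude being unconstrained. -/
def HasScaleInvariantVorticityDirection (v : ℝ → EuclideanSpace ℝ (Fin 3) → EuclideanSpace ℝ (Fin 3)) : Prop :=
  ∀ κ : ℝ, 0 < κ → κ < 1 → HasParallelVorticityEcho κ v

/-! ## §1 Route texts (fully qualified; binder-free) -/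

/-- crux (rank 3) · K1-dir · THE UNIVERSAL DIRECTION-ECHO ZOOM: local (time) Type I at `(x₀,T)` + backward unboundedness
⇒ ONE door-class profile, backward-singular at the apex, on which EVERY faded direction echo through ANY open window
imprints the parallel vorticity echo at that ratio.  (Tree first-order zoom `localPointZoomVelGradSlices` — velocity AND
gradient slices converge — + Fatou on the window + analyticity of slices, hence of `z ↦ ω_v(s,z) × ω_v(κ s, √κ z)`,
to spread the identity from the window cone to the slab.)  Why it might fail: only clerically (the `√ν`-bookkeeping of
ROUND-22 `twoTime_windowLimit`; `curl` is a fixed linear image of `fderiv`, so gradient convergence gives vorticity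
convergence). -/
def LocalPointZoomDirEcho : Prop :=
  ∀ (ν T : ℝ), 0 < ν → 0 < T → ∀ (u : ℝ → EuclideanSpace ℝ (Fin 3) → EuclideanSpace ℝ (Fin 3)) (p : ℝ → EuclideanSpace ℝ (Fin 3) → ℝ), Literature.Analysis.FluidPDE.IsClassicalNSSolutionOn (Set.Ico 0 T) ν 0 u p → Literature.Analysis.FluidPDE.IsLerayHopfOn T ν 0 (u 0) u → Literature.Analysis.FluidPDE.HasRapidSpatialDecay (u 0) → ∀ (x₀ : EuclideanSpace ℝ (Fin 3)) (ρ M : ℝ), 0 < ρ → (∀ t ∈ Set.Ico 0 T, T - ρ ^ 2 < t → ∀ x ∈ Metric.ball x₀ ρ, ‖u t x‖ * Real.sqrt (ν * (T - t)) ≤ M) → ¬ Literature.Analysis.FluidPDE.IsBackwardBoundedAt u T x₀ → ∃ (C : ℝ) (v : ℝ → EuclideanSpace ℝ (Fin 3) → EuclideanSpace ℝ (Fin 3)), Literature.Analysis.FluidPDE.HasTypeITimeDecay C v ∧ ContinuousOn (Function.uncurry v) (Set.Iio (0 : ℝ) ×ˢ Set.univ) ∧ (∀ s t : ℝ, s <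 t → t < 0 → ∀ x, v t x = Literature.Analysis.UnboundedOperators.heatExtension (v s) (t - s) x - Literature.Analysis.FluidPDE.oseenDuhamel 1 s v v t x) ∧ (∀ t < 0, Literature.Analysis.FluidPDE.VectorCalculus.IsDivFree (v t)) ∧ Literature.Analysis.FluidPDE.IsBackwardSingularPoint v 0 ∧ ∀ (κ : ℝ), 0 < κ → κ < 1 → ∀ (U : Set (EuclideanSpace ℝ (Fin 3))), IsOpen U → U.Nonempty → DirEchoFades T x₀ u κ U → HasParallelVorticityEcho κ v

/-- crux (rank 2) · K2-dir · THE SCALE-INVARIANT-DIRECTION LIOUVILLE STATEMENT (NEW; the typed first statement not in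
print): a door-class profile (Type-I time rate, continuous on the open slab, unit-viscosity Oseen–Duhamel between negative
times, divergence free) whose vorticity direction field is invariant under every parabolic dilation is not backward-singular
at the apex.  Contains the CLOSED strata «constant direction» (KNSS 2D Liouville; Giga–Miura 2011), «ξ = ±e_θ»
(axisymmetric without swirl, KNSS 2009) and «self-similar» (Tsai 1998); excludes the generic discretely self-similar
profile (hard core 10661: a DSS profile echoes at one ratio only).  Why it might fail: a Type-I ancient solution whose
vorticity MAGNITUDE oscillates log-periodically in similarity variables while its direction pattern is frozen is not
excluded by any theorem in print; the statement is open exactly there. -/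
def SIDirectionLiouville : Prop :=
  ∀ (C : ℝ) (v : ℝ → EuclideanSpace ℝ (Fin 3) → EuclideanSpace ℝ (Fin 3)), Literature.Analysis.FluidPDE.HasTypeITimeDecay C v → ContinuousOn (Function.uncurry v) (Set.Iio (0 : ℝ) ×ˢ Set.univ) → (∀ s t : ℝ, s < t → t < 0 → ∀ x, v t x = Literature.Analysis.UnboundedOperators.heatExtension (v s) (t - s) x - Literature.Analysis.FluidPDE.oseenDuhamel 1 s v v t x) → (∀ t < 0, Literature.Analysis.FluidPDE.VectorCalculus.IsDivFree (v t)) → HasScaleInvariantVorticityDirection v → ¬ Literature.Analysis.FluidPDE.IsBackwardSingularPoint v 0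

/-- target (rank 0) · DOOR T2-dir «no total direction echo»: classical NS solution on `[0,T)`, Leray–Hopf from a rapidly
decaying datum, locally (time) Type I at `(x₀,T)`; if at EVERY ratio `κ ∈ (0,1)` the two-time direction defect fades in
`L¹` on some nonempty open window of similarity coordinates, then `u` is backward bounded at `(x₀,T)`.
CONDITIONAL on `SIDirectionLiouville` (K2-dir); K1-dir is tree-provable. -/
def TargetDirEchoAllRatios : Prop :=
  ∀ (ν T : ℝ), 0 < ν → 0 < T → ∀ (u : ℝ → EuclideanSpace ℝ (Fin 3) → EuclideanSpace ℝ (Fin 3)) (p : ℝ → EuclideanSpace ℝ (Fin 3) → ℝ), Literature.Analysis.FluidPDE.IsClassicalNSSolutionOn (Set.Ico 0 T) ν 0 u p → Literature.Analysis.FluidPDE.IsLerayHopfOn T ν 0 (u 0) u → Literature.Analysis.FluidPDE.HasRapidSpatialDecay (u 0) → ∀ (x₀ : EuclideanSpace ℝ (Fin 3)) (ρ M : ℝ), 0 < ρ → (∀ t ∈ Set.Ico 0 T, T - ρ ^ 2 < t → ∀ x ∈ Metric.ball x₀ ρ, ‖u t x‖ * Real.sqrt (ν * (T - t)) ≤ M)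 → (∀ κ : ℝ, 0 < κ → κ < 1 → ∃ U : Set (EuclideanSpace ℝ (Fin 3)), IsOpen U ∧ U.Nonempty ∧ DirEchoFades T x₀ u κ U) → Literature.Analysis.FluidPDE.IsBackwardBoundedAt u T x₀

/-- assembly (rank 1) · K1-dir → K2-dir → door T2-dir. -/
def DirEchoAssembly : Prop :=
  LocalPointZoomDirEcho → SIDirectionLiouville → TargetDirEchoAllRatios

end Summit.NavierStokesRegularity.NavierStokesRegularity.Theorems.DirectionEchoDoorDefs
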